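/-
Copyright (c) 2026. All rights reserved.
Released under Apache 2.0 license as described in the file LICENSE.
Authors: abc-iut cell, wave-4 prover seat abc-iut-w4-d017 (gen 4; proof-only, over `UnitLogCyclotomicThree`,
abc-iut-S1's `LocalUnitLog` / `LogSeriesEstimates` and abc-iut-S7's `RescaledCompletion`).
-/
import Literature.IUT.LogVolume.UnitLogCyclotomicThree
import HarnessLib

/-!
# `log_p(𝒪^×) = 𝔪²` for the completion of `ℚ(ζ_p)` at `λ = ζ_p − 1` (every odd prime `p`; `e = p − 1`)

Classical local analysis (Washington, *Introduction to Cyclotomic Fields*, Lemma 1.4 and §5.1; Neukirch,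
*Algebraic Number Theory*, Ch. II (5.5); Koblitz, GTM 58, Ch. IV §1–2). For `K = ℚ(ζ_p)` completed at
`v = (ζ_p − 1)`: `K_v = ℚ_p(ζ_p)`, `e = p − 1`, `f = 1`, uniformizer `λ = ζ_p − 1`, `λ^{p−1} ~ p`, so
`‖λ‖ = p^{−1/(p−1)}` is EXACTLY the convergence boundary of the logarithmic series. The generic bound of
`UnitLogIntoMaximalIdeal` (`e ≤ p − 1`) gives `log(𝒪_v^×) ⊆ 𝔪_v`; the truth is one step sharper:
**`log(𝒪_v^×) = 𝔪_v² = λ²𝒪_v`**, because `1 + 𝔪_v = μ_p · (1 + 𝔪_v²)` (`𝒪_v/𝔪_v = 𝔽_p` and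
`ζ_p^k ≡ 1 + kλ (mod λ²)`), `log` kills `μ_p`, and on `1 + 𝔪_v² = {‖1 − y‖ ≤ ‖λ‖²}` the logarithmic series is
a `1`-Lipschitz BIJECTION onto `𝔪_v²` (`‖λ‖² · p^{1/(p−1)} = p^{−1/(p−1)} < 1`). Consequently the
[IUTchIII] Rmk. 1.2.2 (i) log-shell of `ℚ_p(ζ_p)` is `I_v = p⁻¹ · log(𝒪_v^×) = (λ²/p) · 𝒪_v`, whose centre
`c₀ = λ²/p` has `ord(c₀) = (3 − p)/(p − 1)`, NOT the order of any rational number once `p ≥ 5` (for `p = 3`,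
`c₀ ∼ 1`: `UnitLogCyclotomicThree`, `UnitLogZetaThree`). PROOF-ONLY file (no definitions), in the setting
of `UnitLogCyclotomicThree` (`RescaledCompletion K p v`, normed `ℚ_p`-algebra on the completion `K_v`):
* `exists_int_dvd_sub_of_isCyclotomic` — `𝓞 = ℤ[ζ_p]` ⇒ every algebraic integer is `≡` an integer `(mod λ)`;
  `asIdeal_eq_span_zeta_sub_one_of_mem` — the unique place over `p` is `(ζ_p − 1)`;
* `exists_one_add_pow_eq` — `(1 + λ)^k = 1 + kλ + λ² q` with `‖q‖ ≤ 1`;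
* `exists_twist_norm_le_sq` — every principal unit is `‖λ‖²`-close to `1` after a twist by a power of `ζ_p`;
* `norm_zeta_sub_one_pow`, `norm_zeta_sub_one_eq_rpow` — `‖λ‖^{p−1} = p⁻¹`, `‖λ‖ = p^{−1/(p−1)}`;
* **`norm_unitLog_le_norm_sq`** — `‖log u‖ ≤ ‖λ‖²` for every unit; **`logUnits_eq_closedBall_sq`** —
  `log(𝒪_v^×) = closedBall 0 ‖λ‖²` (`⊇` by abc-iut-S1's successive approximation `exists_logSeries_eq`).
Nothing here is disputed mathematics and nothing bears on [IUTchIII] Cor. 3.12.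
-/

noncomputable section

open Metric Set NumberField IsDedekindDomain

namespace Literature.IUT.LogVolume.CyclotomicPrime

open Literature.NumberTheory.NumberFields Literature.IUT.LogVolume.CyclotomicThree

/-! ## §1. Residues modulo `ζ_p − 1` and the place over `p` -/

section Residues

variable {K : Type} [Field K] [NumberField K] {p : ℕ} [hp : Fact p.Prime]
  [hK : IsCyclotomicExtension {p} ℚ K] {ζ : K} (hζ : IsPrimitiveRoot ζ p)

/-- **`𝓞_{ℚ(ζ_p)} ≡ ℤ (mod ζ_p − 1)`**: every algebraic integer of `ℚ(ζ_p)` is congruent to a rational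
integer modulo `λ = ζ_p − 1` (`𝓞 = ℤ[ζ_p]`, Mathlib `IsCyclotomicExtension.Rat.adjoin_singleton_eq_top`, and
`ζ_p ≡ 1`) — Washington Lemma 1.4 / Neukirch I (10.1): `(1 − ζ)` is a prime of residue degree `1`.
[cite: NeukirchANT1999, Ch. I Lemma (10.1)] -/
theorem exists_int_dvd_sub_of_isCyclotomic (a : 𝓞 K) : ∃ N : ℤ, hζ.toInteger - 1 ∣ a - N := by
  have hmem : a ∈ Algebra.adjoin ℤ ({hζ.toInteger} : Set (𝓞 K)) := by
    rw [IsCyclotomicExtension.Rat.adjoin_singleton_eq_top hζ]; trivial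
  induction hmem using Algebra.adjoin_induction with
  | mem x hx =>
    rw [Set.mem_singleton_iff] at hx
    subst hx
    exact ⟨1, by simp⟩
  | algebraMap r => exact ⟨r, by simp⟩
  | add x y _ _ hx hy =>
    obtain ⟨N, hN⟩ := hx
    obtain ⟨M, hM⟩ := hy
    refine ⟨N + M, ?_⟩
    have : x + y - ((N + M : ℤ) : 𝓞 K) = (x - N) + (y - M) := by push_cast; ring
    rw [this]
    exact dvd_add hN hM
  | mul x y _ _ hx hy =>
    obtain ⟨N, hN⟩ := hx
    obtain ⟨M, hM⟩ := hy
    refine ⟨N * M, ?_⟩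
    have : x * y - ((N * M : ℤ) : 𝓞 K) = x * (y - M) + (M : 𝓞 K) * (x - N) := by push_cast; ring
    rw [this]
    exact dvd_add (dvd_mul_of_dvd_right hM _) (dvd_mul_of_dvd_right hN _)

/-- A finite place of `ℚ(ζ_p)` containing `p` IS the place `(ζ_p − 1)` (Mathlib
`IsCyclotomicExtension.Rat.eq_span_zeta_sub_one_of_liesOver'`: the unique prime over `p`, totally ramified,
`p𝓞 = (1 − ζ_p)^{p−1}`). [cite: NeukirchANT1999, Ch. I Lemma (10.1)] -/
theorem asIdeal_eq_span_zeta_sub_one_of_mem (v : HeightOneSpectrum (𝓞 K))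
    (hvp : ((p : ℕ) : 𝓞 K) ∈ v.asIdeal) : v.asIdeal = Ideal.span {hζ.toInteger - 1} := by
  have hle : Ideal.span {(p : ℤ)} ≤ v.asIdeal.under ℤ := by
    rw [Ideal.span_le, Set.singleton_subset_iff]
    show algebraMap ℤ (𝓞 K) (p : ℤ) ∈ v.asIdeal
    simpa using hvp
  have hmax : (Ideal.span {(p : ℤ)}).IsMaximal :=
    PrincipalIdealRing.isMaximal_of_irreducible (Nat.prime_iff_prime_int.mp hp.out).irreducible
  have hne : v.asIdeal.under ℤ ≠ ⊤ := Ideal.comap_ne_top _ v.isPrime.ne_top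
  haveI : v.asIdeal.LiesOver (Ideal.span {(p : ℤ)}) := ⟨hmax.eq_of_le hne hle⟩
  exact IsCyclotomicExtension.Rat.eq_span_zeta_sub_one_of_liesOver' p K hζ v.asIdeal

end Residues

/-! ## §2. The twist into `1 + 𝔪_v²` and the bound `‖log u‖ ≤ ‖λ‖²` -/

section Bound

variable {K : Type} [Field K] [NumberField K] (p : ℕ) [hp : Fact p.Prime]
variable (v : HeightOneSpectrum (𝓞 K)) (hvp : ((p : ℕ) : 𝓞 K) ∈ v.asIdeal)

/-- Integers have norm `≤ 1` in the rescaled completion (a normed `ℚ_p`-algebra).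
[cite: NeukirchANT1999, Ch. II Prop. (3.3)] -/
theorem norm_intCast_le_one (m : ℤ) : ‖(m : RescaledCompletion K p v hvp)‖ ≤ 1 := by
  rw [← map_intCast (algebraMap ℚ_[p] (RescaledCompletion K p v hvp)), norm_algebraMap']
  exact Padic.norm_int_le_one m

/-- **`(1 + λ)^k = 1 + kλ + λ²·q` with `q` integral** (binomial expansion, ultrametric bookkeeping).
[cite: Koblitz1984, Ch. IV §1] -/
theorem exists_one_add_pow_eq (lam : RescaledCompletion K p v hvp) (hlam : ‖lam‖ ≤ 1) (k : ℕ) :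
    ∃ q : RescaledCompletion K p v hvp, ‖q‖ ≤ 1 ∧ (1 + lam) ^ k = 1 + (k : RescaledCompletion K p v hvp) * lam + lam ^ 2 * q := by
  induction k with
  | zero => exact ⟨0, by simp, by simp⟩
  | succ k ih =>
    obtain ⟨q, hq, hk⟩ := ih
    refine ⟨(k : RescaledCompletion K p v hvp) + q + lam * q, ?_, ?_⟩
    · have hkn : ‖(k : RescaledCompletion K p v hvp)‖ ≤ 1 := by exact_mod_cast norm_intCast_le_one p v hvp k
      refine (IsUltrametricDist.norm_add_le_max _ _).trans (max_le ?_ ?_)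
      · exact (IsUltrametricDist.norm_add_le_max _ _).trans (max_le hkn hq)
      · rw [norm_mul]
        calc ‖lam‖ * ‖q‖ ≤ 1 * 1 := by gcongr
          _ = 1 := one_mul 1
    · rw [pow_succ, hk]; push_cast; ring

variable [hK : IsCyclotomicExtension {p} ℚ K] {ζ : K} (hζ : IsPrimitiveRoot ζ p)

/-- **The twist.** At the place `v = (ζ_p − 1)`: every principal unit `y` of the completion satisfies
`‖1 − ζ·y‖ ≤ ‖λ‖²` for some `p`-th root of unity `ζ = ζ_p^k` — i.e. `1 + 𝔪_v = μ_p · (1 + 𝔪_v²)`: write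
`1 − y = λ(N + λ s)` with `N ∈ ℤ` (`exists_int_dvd_sub_of_isCyclotomic` + density) and take `k ≡ N (mod p)`;
then `ζ_p^k y ≡ (1 + kλ)(1 − Nλ) ≡ 1 (mod λ²)` as `p ∣ k − N` and `‖p‖ ≤ ‖λ‖`.
[cite: Koblitz1984, Ch. IV §1] -/
theorem exists_twist_norm_le_sq (hv : v.asIdeal = Ideal.span {hζ.toInteger - 1})
    (y : RescaledCompletion K p v hvp) (hy : IsPrincipal y) :
    ∃ ζ' : RescaledCompletion K p v hvp, ∃ n : ℕ, 0 < n ∧ ζ' ^ n = 1 ∧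
      ‖1 - ζ' * y‖ ≤ ‖RescaledCompletion.of K p v hvp (algebraMap K (v.adicCompletion K) ζ) - 1‖ ^ 2 := by
  have hp0 : 0 < p := hp.out.pos
  set e := RescaledCompletion.of K p v hvp with he
  set ι : K →+* RescaledCompletion K p v hvp := e.toRingHom.comp (algebraMap K (v.adicCompletion K))
    with hι
  have hιe : ∀ k : K, ι k = e (algebraMap K (v.adicCompletion K) k) := fun k => rfl
  set z : RescaledCompletion K p v hvp := ι ζ with hz
  show ∃ ζ' : RescaledCompletion K p v hvp, ∃ n : ℕ, 0 < n ∧ ζ' ^ n = 1 ∧ ‖1 - ζ' * y‖ ≤ ‖z - 1‖ ^ 2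
  have hzp : z ^ p = 1 := by rw [hz, ← map_pow, hζ.pow_eq_one, map_one]
  -- `λ = z - 1` is the image of the generator of `v`
  have hne0 : hζ.toInteger - 1 ≠ 0 := by
    intro h
    have : (hζ.toInteger : K) = 1 := by
      have := congrArg (fun x : 𝓞 K => (x : K)) (sub_eq_zero.mp h); simpa using this
    exact hζ.ne_one hp.out.one_lt (by simpa [IsPrimitiveRoot.coe_toInteger] using this)
  have hlam_eq : e (algebraMap K (v.adicCompletion K) (((hζ.toInteger - 1 : 𝓞 K) : K))) = z - 1 := by
    rw [← hιe, hz]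
    have : (((hζ.toInteger - 1 : 𝓞 K) : K)) = ζ - 1 := by
      rw [RingOfIntegers.coe_eq_algebraMap, map_sub, map_one]; rfl
    rw [this, map_sub, map_one]
  have hdisc : ∀ x : RescaledCompletion K p v hvp, ‖x‖ < 1 → ‖x‖ ≤ ‖z - 1‖ := by
    intro x hx
    have := norm_le_norm_of_generator p v hvp hne0 hv x hx
    rwa [hlam_eq] at this
  have hlam_lt : ‖z - 1‖ < 1 := by
    rw [← hlam_eq, norm_of_coe_lt_one_iff_mem, hv]; exact Ideal.mem_span_singleton_self _
  have hzle : ‖z - 1‖ ≤ 1 := hlam_lt.le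
  -- `‖p‖ ≤ ‖λ‖`
  have hpn : ‖(p : RescaledCompletion K p v hvp)‖ = (p : ℝ)⁻¹ := norm_prime p (RescaledCompletion K p v hvp)
  have hplt : ‖(p : RescaledCompletion K p v hvp)‖ < 1 := by
    rw [hpn]; exact inv_lt_one_of_one_lt₀ (by exact_mod_cast hp.out.one_lt)
  have hple : ‖(p : RescaledCompletion K p v hvp)‖ ≤ ‖z - 1‖ := hdisc _ hplt
  have hlampos : 0 < ‖z - 1‖ := lt_of_lt_of_le (by rw [hpn]; positivity) hple
  have hlam0 : z - 1 ≠ 0 := norm_pos_iff.mp hlampos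
  -- `1 - y = λ t`, `‖t‖ ≤ 1`
  set t := (1 - y) / (z - 1) with ht
  have ht1 : ‖t‖ ≤ 1 := by
    rw [ht, norm_div, div_le_one hlampos]; exact hdisc _ hy
  have hyt : 1 - y = (z - 1) * t := by rw [ht]; field_simp
  -- `t ≡ N (mod λ)`, `N ∈ ℤ`; `t - N = λ s`, `‖s‖ ≤ 1`
  obtain ⟨a, ha⟩ := exists_int_norm_sub_lt_one p v hvp t ht1
  obtain ⟨N, hdvd⟩ := exists_int_dvd_sub_of_isCyclotomic hζ a
  have haN : ‖ι (a : K) - (N : RescaledCompletion K p v hvp)‖ < 1 := by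
    have h1 : ι (a : K) - (N : RescaledCompletion K p v hvp) = ι (((a - N : 𝓞 K)) : K) := by
      simp only [RingOfIntegers.coe_eq_algebraMap, map_sub, map_intCast]
    rw [h1, hιe, norm_of_coe_lt_one_iff_mem, hv]
    exact Ideal.mem_span_singleton.mpr hdvd
  have htN : ‖t - (N : RescaledCompletion K p v hvp)‖ < 1 := by
    have : t - (N : RescaledCompletion K p v hvp) = (t - ι (a : K)) + (ι (a : K) - N) := by ring
    rw [this]
    refine (IsUltrametricDist.norm_add_le_max _ _).trans_lt (max_lt ?_ haN)
    rw [hιe]; exact ha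
  set s := (t - N) / (z - 1) with hs
  have hs1 : ‖s‖ ≤ 1 := by
    rw [hs, norm_div, div_le_one hlampos]; exact hdisc _ htN
  have hts : t - N = (z - 1) * s := by rw [hs]; field_simp
  -- the exponent `k ≡ N (mod p)` and `N - k = p m`
  obtain ⟨k, m, hkm⟩ : ∃ k : ℕ, ∃ m : ℤ, (N : ℤ) - k = p * m := by
    refine ⟨(N % p).toNat, N / p, ?_⟩
    have h0 : 0 ≤ N % p := Int.emod_nonneg _ (by exact_mod_cast hp0.ne')
    rw [Int.toNat_of_nonneg h0]
    have := Int.emod_def N p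
    linarith
  -- `(1 + λ)^k = 1 + kλ + λ² q`
  obtain ⟨q, hq1, hzk⟩ := exists_one_add_pow_eq p v hvp (z - 1) hzle k
  rw [add_sub_cancel] at hzk
  refine ⟨z ^ k, p, hp0, by rw [← pow_mul, mul_comm, pow_mul, hzp, one_pow], ?_⟩
  -- `1 - z^k y = (N - k)λ + λ²·E`
  have hy' : y = 1 - (N : RescaledCompletion K p v hvp) * (z - 1) - (z - 1) ^ 2 * s := by
    linear_combination -hyt - (z - 1) * hts
  have hNk : ((N : RescaledCompletion K p v hvp) - (k : RescaledCompletion K p v hvp)) =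
      (p : RescaledCompletion K p v hvp) * (m : RescaledCompletion K p v hvp) := by
    exact_mod_cast congrArg (fun x : ℤ => (x : RescaledCompletion K p v hvp)) hkm
  have hid : 1 - z ^ k * y =
      (p : RescaledCompletion K p v hvp) * (m : RescaledCompletion K p v hvp) * (z - 1) +
        (z - 1) ^ 2 * (s + (k : RescaledCompletion K p v hvp) * N + (k : RescaledCompletion K p v hvp) * (z - 1) * s
          - q + (N : RescaledCompletion K p v hvp) * (z - 1) * q + (z - 1) ^ 2 * q * s) := by
    rw [hzk, hy', ← hNk]; ring
  have hkn : ‖(k : RescaledCompletion K p v hvp)‖ ≤ 1 := by exact_mod_cast norm_intCast_le_one p v hvp k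
  have hNn : ‖(N : RescaledCompletion K p v hvp)‖ ≤ 1 := norm_intCast_le_one p v hvp N
  have hmn : ‖(m : RescaledCompletion K p v hvp)‖ ≤ 1 := norm_intCast_le_one p v hvp m
  -- ultrametric bookkeeping: the bracket has norm `≤ 1`
  have hmul : ∀ a b : RescaledCompletion K p v hvp, ‖a‖ ≤ 1 → ‖b‖ ≤ 1 → ‖a * b‖ ≤ 1 := by
    intro a b ha hb
    rw [norm_mul]
    calc ‖a‖ * ‖b‖ ≤ 1 * 1 := by gcongr
      _ = 1 := one_mul 1
  have hadd : ∀ a b : RescaledCompletion K p v hvp, ‖a‖ ≤ 1 → ‖b‖ ≤ 1 → ‖a + b‖ ≤ 1 := fun a b ha hb =>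
    (IsUltrametricDist.norm_add_le_max _ _).trans (max_le ha hb)
  have hsub : ∀ a b : RescaledCompletion K p v hvp, ‖a‖ ≤ 1 → ‖b‖ ≤ 1 → ‖a - b‖ ≤ 1 := fun a b ha hb => by
    rw [sub_eq_add_neg]; exact hadd _ _ ha (by rwa [norm_neg])
  have hz2 : ‖(z - 1) ^ 2‖ ≤ 1 := by rw [norm_pow]; exact pow_le_one₀ (norm_nonneg _) hzle
  have hE : ‖s + (k : RescaledCompletion K p v hvp) * N + (k : RescaledCompletion K p v hvp) * (z - 1) * s
      - q + (N : RescaledCompletion K p v hvp) * (z - 1) * q + (z - 1) ^ 2 * q * s‖ ≤ 1 :=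
    hadd _ _ (hadd _ _ (hsub _ _ (hadd _ _ (hadd _ _ hs1 (hmul _ _ hkn hNn))
      (hmul _ _ (hmul _ _ hkn hzle) hs1)) hq1) (hmul _ _ (hmul _ _ hNn hzle) hq1))
      (hmul _ _ (hmul _ _ hz2 hq1) hs1)
  rw [hid]
  refine (IsUltrametricDist.norm_add_le_max _ _).trans (max_le ?_ ?_)
  · rw [norm_mul, norm_mul, sq]
    calc ‖(p : RescaledCompletion K p v hvp)‖ * ‖(m : RescaledCompletion K p v hvp)‖ * ‖z - 1‖
        ≤ ‖z - 1‖ * 1 * ‖z - 1‖ := by gcongr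
      _ = ‖z - 1‖ * ‖z - 1‖ := by rw [mul_one]
  · rw [norm_mul, norm_pow]
    calc ‖z - 1‖ ^ 2 * _ ≤ ‖z - 1‖ ^ 2 * 1 := by gcongr
      _ = ‖z - 1‖ ^ 2 := mul_one _

omit hK in
include hζ in
/-- **`‖ζ_p − 1‖^{p−1} = p⁻¹`** in the rescaled completion: `(ζ_p − 1)^{p−1} ~ p` in `𝓞` (Mathlib
`IsCyclotomicExtension.Rat.associated_zeta_sub_one_pow_prime`), units of `𝓞` have norm `1` at `v`, and
`‖p‖ = p⁻¹`. [cite: NeukirchANT1999, Ch. I Lemma (10.1)] -/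
theorem norm_zeta_sub_one_pow :
    ‖RescaledCompletion.of K p v hvp (algebraMap K (v.adicCompletion K) ζ) - 1‖ ^ (p - 1) = (p : ℝ)⁻¹ := by
  set e := RescaledCompletion.of K p v hvp with he
  set ι : K →+* RescaledCompletion K p v hvp := e.toRingHom.comp (algebraMap K (v.adicCompletion K))
    with hι
  have hιe : ∀ k : K, ι k = e (algebraMap K (v.adicCompletion K) k) := fun k => rfl
  obtain ⟨u, hu⟩ := IsCyclotomicExtension.Rat.associated_zeta_sub_one_pow_prime p hζ
  -- map `(ζ-1)^(p-1) * u = p` into the completion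
  have hmap : (ι ζ - 1) ^ (p - 1) * ι ((u : 𝓞 K) : K) = (p : RescaledCompletion K p v hvp) := by
    have h := congrArg (fun x : 𝓞 K => ι (x : K)) hu
    simp only [map_mul, map_pow, map_sub, map_one, map_natCast] at h
    rw [← h]
    rfl
  -- `‖ι u‖ = 1`
  have hu1 : ‖ι ((u : 𝓞 K) : K)‖ = 1 := by
    have hle : ‖ι ((u : 𝓞 K) : K)‖ ≤ 1 := by
      rw [hιe, norm_of_coe_le_one_iff, RingOfIntegers.coe_eq_algebraMap]
      exact HeightOneSpectrum.valuation_le_one v _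
    have hnlt : ¬ ‖ι ((u : 𝓞 K) : K)‖ < 1 := by
      rw [hιe, norm_of_coe_lt_one_iff_mem]
      intro hmem
      exact v.isPrime.ne_top (Ideal.eq_top_of_isUnit_mem _ hmem u.isUnit)
    exact le_antisymm hle (not_lt.mp hnlt)
  have := congrArg norm hmap
  rw [norm_mul, hu1, mul_one, norm_pow, norm_prime p (RescaledCompletion K p v hvp)] at this
  rw [hιe] at this
  exact this

omit hK in
include hζ in
/-- … hence **`‖ζ_p − 1‖ = p^{−1/(p−1)}`**, the convergence boundary of the logarithmic series.
[cite: NeukirchANT1999, Ch. II Prop. (5.5)] -/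
theorem norm_zeta_sub_one_eq_rpow :
    ‖RescaledCompletion.of K p v hvp (algebraMap K (v.adicCompletion K) ζ) - 1‖ =
      (p : ℝ) ^ (-(1 / ((p : ℝ) - 1))) := by
  have h := norm_zeta_sub_one_pow p v hvp hζ
  have hp1 : 1 ≤ p := hp.out.one_lt.le
  have hne : (p - 1 : ℕ) ≠ 0 := by have := hp.out.two_le; omega
  have hcast : ((p - 1 : ℕ) : ℝ) = (p : ℝ) - 1 := by rw [Nat.cast_sub hp1, Nat.cast_one]
  have hx : 0 ≤ ‖RescaledCompletion.of K p v hvp (algebraMap K (v.adicCompletion K) ζ) - 1‖ := norm_nonneg _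
  calc ‖RescaledCompletion.of K p v hvp (algebraMap K (v.adicCompletion K) ζ) - 1‖
      = (‖RescaledCompletion.of K p v hvp (algebraMap K (v.adicCompletion K) ζ) - 1‖ ^ (p - 1)) ^
          (((p - 1 : ℕ) : ℝ)⁻¹) := (Real.pow_rpow_inv_natCast hx hne).symm
    _ = ((p : ℝ)⁻¹) ^ (((p - 1 : ℕ) : ℝ)⁻¹) := by rw [h]
    _ = (p : ℝ) ^ (-(1 / ((p : ℝ) - 1))) := by
        rw [hcast, Real.inv_rpow (by positivity), ← Real.rpow_neg (by positivity), one_div]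

/-- **`‖log u‖ ≤ ‖ζ_p − 1‖²` for every unit of the completion of `ℚ(ζ_p)` at `(ζ_p − 1)`**, i.e.
`log(𝒪_v^×) ⊆ 𝔪_v²`: the abstract twisted Lipschitz bound `norm_unitLog_le_of_forall_isPrincipal_twist`
at `ρ = ‖λ‖² = p^{−2/(p−1)}` (`ρ · p^{1/(p−1)} = p^{−1/(p−1)} ≤ 1`) with the twist `exists_twist_norm_le_sq`.
[cite: NeukirchANT1999, Ch. II Prop. (5.5)] -/
theorem norm_unitLog_le_norm_sq (hv : v.asIdeal = Ideal.span {hζ.toInteger - 1})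
    (u : RescaledCompletion K p v hvp) (hu : ‖u‖ = 1) :
    ‖unitLog u‖ ≤ ‖RescaledCompletion.of K p v hvp (algebraMap K (v.adicCompletion K) ζ) - 1‖ ^ 2 := by
  have hlam := norm_zeta_sub_one_eq_rpow p v hvp hζ
  refine norm_unitLog_le_of_forall_isPrincipal_twist p ?_ (exists_twist_norm_le_sq p v hvp hζ hv) hu
  rw [hlam, ← Real.rpow_natCast, ← Real.rpow_mul (by positivity), ← Real.rpow_add (by exact_mod_cast hp.out.pos)]
  have hp2 : (2 : ℝ) ≤ p := by exact_mod_cast hp.out.two_le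
  have hexp : -(1 / ((p : ℝ) - 1)) * ((2 : ℕ) : ℝ) + 1 / ((p : ℝ) - 1) = -(1 / ((p : ℝ) - 1)) := by
    push_cast; ring
  rw [hexp]
  exact Real.rpow_le_one_of_one_le_of_nonpos (by linarith)
    (by rw [neg_nonpos]; exact div_nonneg zero_le_one (by linarith))

/-- **`log(𝒪_v^×) = 𝔪_v² = closedBall 0 ‖ζ_p − 1‖²`** for the completion of `ℚ(ζ_p)` at `(ζ_p − 1)`:
`⊆` is `norm_unitLog_le_norm_sq`; `⊇` is abc-iut-S1's successive approximation `exists_logSeries_eq`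
(`ρ · p^{1/(p−1)} = p^{−1/(p−1)} < 1`): every `z` with `‖z‖ ≤ ‖λ‖²` is `L(y) = log y` for a principal `y`.
[cite: NeukirchANT1999, Ch. II Prop. (5.5)] -/
theorem logUnits_eq_closedBall_sq (hv : v.asIdeal = Ideal.span {hζ.toInteger - 1}) :
    logUnits (RescaledCompletion K p v hvp) =
      closedBall 0 (‖RescaledCompletion.of K p v hvp (algebraMap K (v.adicCompletion K) ζ) - 1‖ ^ 2) := by
  have hlam := norm_zeta_sub_one_eq_rpow p v hvp hζ
  have hp2 : (2 : ℝ) ≤ p := by exact_mod_cast hp.out.two_le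
  have hθ : ‖RescaledCompletion.of K p v hvp (algebraMap K (v.adicCompletion K) ζ) - 1‖ ^ 2 *
      (p : ℝ) ^ (1 / ((p : ℝ) - 1)) < 1 := by
    rw [hlam, ← Real.rpow_natCast, ← Real.rpow_mul (by positivity),
      ← Real.rpow_add (by exact_mod_cast hp.out.pos)]
    have hexp : -(1 / ((p : ℝ) - 1)) * ((2 : ℕ) : ℝ) + 1 / ((p : ℝ) - 1) = -(1 / ((p : ℝ) - 1)) := by
      push_cast; ring
    rw [hexp]
    exact Real.rpow_lt_one_of_one_lt_of_neg (by exact_mod_cast hp.out.one_lt)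
      (by rw [neg_lt_zero]; exact div_pos one_pos (by linarith))
  ext w
  rw [mem_logUnits_iff, mem_closedBall, dist_zero_right]
  constructor
  · rintro ⟨u, hu, rfl⟩
    exact norm_unitLog_le_norm_sq p v hvp hζ hv u hu
  · intro hw
    obtain ⟨y, hy, hyw⟩ := exists_logSeries_eq p (RescaledCompletion K p v hvp) hθ hw
    have hρ1 : ‖RescaledCompletion.of K p v hvp (algebraMap K (v.adicCompletion K) ζ) - 1‖ ^ 2 < 1 := by
      have h1 : 1 ≤ (p : ℝ) ^ (1 / ((p : ℝ) - 1)) :=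
        Real.one_le_rpow (by exact_mod_cast hp.out.one_lt.le) (div_nonneg zero_le_one (by linarith))
      have h0 : 0 ≤ ‖RescaledCompletion.of K p v hvp (algebraMap K (v.adicCompletion K) ζ) - 1‖ ^ 2 :=
        by positivity
      nlinarith
    have hyP : IsPrincipal y := lt_of_le_of_lt hy hρ1
    exact ⟨y, hyP.norm_eq_one, by rw [unitLog_of_isPrincipal p hyP, hyw]⟩

end Bound

end Literature.IUT.LogVolume.CyclotomicPrime

end
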